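import Mathlib.Analysis.Normed.Module.PiTensorProduct.ProjectiveSeminorm
import Mathlib.Algebra.BigOperators.Finprod
import HarnessLib

/-!
# Joshi's §7.6 «Norms on tensor product of Banach spaces», part 2 (arXiv:2401.13508 v4, PDF p. 64 l. 27 – p. 65 l. 10):
# the lower-bound lemma (7.6.6.3), the adelic sizes `|S_p|`, `|S|` of §7.6.7 and the (bounded) adelic type of §7.6.9,
# with the §7.6.8 shape behind Lemma 7.6.9.1 — TYPED in `ℝ≥0∞`; no side taken

Record file of the abc-iut cell, branch E «type Joshi's construction, test vs S» (rung LADDER-ABC:A2.E; seat abc-iut-E-t14,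
slot T-14; node ids `J3:Lem7.6.6.1`, `J3:Lem7.6.9.1` of `plan/E/JOSHI-DAG.tsv`). Source, render, bib key (`Joshi2024ATS3`),
claim status and framing exactly as in the companion file `Joshi/TensorNorms.lean` (part 1: (7.6.2.1), Thm 7.6.2.2,
Lemmas 7.6.4.1 / 7.6.5.1 / (7.6.6.2)); this part is independent of it (no import either way), so that the cross-norm identity
enters (7.6.6.3) as an explicit hypothesis `‖⨂ₜ m‖ = ∏ ‖m_i‖` — discharged over `ℝ`, `ℂ` by `TensorNorm.norm_tprod` there and
over a p-adic field by Joshi's cited claim `TensorNorm.CrossNormClaim` (Thm 7.6.2.2 (3), [Schneider 2002, Prop. 17.4]).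
UNREFEREED preprint [Mochizuki2024JoshiReport disputes it]; typed ≠ proved ≠ endorsed; nothing here asserts abc or
[IUTchIII] Cor. 3.12; §7.6 bears on S = `Cor312Vol.PilotKummerIndRelated` only through volume bookkeeping (E-PLAN R2).

## What §7.6.6 (7.6.6.3) – §7.6.9 say (as printed) and how they are typed

* Lemma 7.6.6.1 (7.6.6.3) (p. 64 l. 27–37): «if `S ⊂ ⊗_α V_α` is a subset containing some pure tensor `⊗_α m_α` then
  `sup{|s|_{⊗V_α} : s ∈ S} ≥ ∏_α |m_α|_{V_α}`». The size `supNorm S = sup_{s ∈ S} ‖s‖` is DEFINED in `ℝ≥0∞` (print allows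
  `|S_p| = ∞`, p. 64 l. 54–58; `supNorm ∅ = 0` is the typing's convention for the empty set, which print never uses) and
  (7.6.6.3) is DERIVED (`prod_enorm_le_supNorm`) from the cross-norm identity (7.6.6.2) taken as a hypothesis.
* §7.6.7 (p. 64 l. 38–58) ADELIC sizes: for every prime `p` a finite collection `{V_{α,p}}`, `S_p ⊆ ⊗_α V_{α,p}`,
  `S = ∏_p S_p`; `|S_p| = sup{|s_p| : s_p ∈ S_p}`; `|S| = ∏_p |S_p| ∈ ℝ ∪ {∞}` «with the convention that `∞ · ∞ = ∞`,
  `0 · ∞ = ∞`» — `localSize`, `adelicSize` over a family of seminormed groups `W_p` indexed by an abstract type `P` of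
  «primes» (Joshi: `W_p = ⊗_α V_{α,p}`, `P` = the rational primes). Joshi's `0 · ∞ = ∞` differs from `ℝ≥0∞`'s `0 · ⊤ = 0`,
  hence the explicit `∞`-override in `adelicSize`; the product over ALL `p` is `finprod`, which is the finite product over the
  exceptional `p` (`|S_p| ≠ 1`) for sets of adelic type — the only case print uses (§7.6.8) — and the junk value `1` otherwise
  (`adelicSize_eq_prod`, `adelicSize_eq_top_iff`).
* §7.6.8 (p. 64 l. 59–67) principal cases: `S_p = Θ̃_{Joshi,p}`, `Θ̃_{Mochizuki,p}` for `p` below `V^{odd,ss}`, and `S_p = {1}`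
  or the unit ball for the remaining `p`; «`|S_p| = 1` for all but finitely many primes `p` and for the remaining finitely
  many primes, one expects `|S_p| < ∞`. So `|S| < ∞`» — `supNorm_singleton`, `supNorm_closedBall_eq_one`,
  `isAdelicType_of_subset`, `adelicSize_lt_top` (DERIVED; «one expects `|S_p| < ∞`» is a hypothesis, not asserted).
* §7.6.9 (p. 65 l. 1–6): (1) ADELIC TYPE «`|S_p| = 1` for all but finitely many primes `p`», (2) BOUNDED ADELIC TYPE «adelic
  type and `|S_p| < ∞` for every prime `p`» — `IsAdelicType`, `IsBoundedAdelicType` (verbatim).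
* Lemma 7.6.9.1 (p. 65 l. 7–10) «The set `Θ̃^{B_{L′}}_Joshi` and its variants for different choices of the `B`-rings are of
  adelic type» («a consequence of the construction of the theta-values sets»): its CONTENT is `isAdelicType_of_subset`
  (the §7.6.8 shape ⇒ adelic type); the INSTANCE — that the loci have the §7.6.8 shape — is stated by the seats typing them
  (abc-iut-E-t11 `J3:Def6.10.2`, abc-iut-E-t13 `J3:(7.5.4.1)`; merge-debt), not here.

Deliberately NOT here: the loci `Θ̃`, the rings `B_E`, any `Cor312*` object, any judgement. No instance, notation or axiom.
-/

noncomputable section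

open scoped TensorProduct ENNReal
open PiTensorProduct

namespace Summit.ABC.IUTFork.Joshi.TensorNorm


/-! ## 1. Lemma 7.6.6.1 (7.6.6.3): the size of a subset and the lower-bound lemma -/

section Sizes

variable {W : Type*} [SeminormedAddCommGroup W]

/-- **`|S| = sup{|s| : s ∈ S}`** [J-III (7.6.6.3) p. 64 l. 30–33; §7.6.7 p. 64 l. 52–53 `|S_p| = sup{|s_p| : s_p ∈ S_p}`], valued in
`ℝ≥0∞` (the value `∞` is allowed in print, p. 64 l. 58; `supNorm ∅ = 0` is this typing's junk-free convention for the empty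
set, which print never uses). -/
def supNorm (S : Set W) : ℝ≥0∞ :=
  ⨆ s ∈ S, ‖s‖ₑ

/-- Every element is dominated: `‖s‖ ≤ |S|` for `s ∈ S`. -/
theorem enorm_le_supNorm {S : Set W} {s : W} (hs : s ∈ S) : ‖s‖ₑ ≤ supNorm S :=
  le_iSup₂ (f := fun (s : W) (_ : s ∈ S) => ‖s‖ₑ) s hs

/-- `|S| ≤ c` iff every element has norm `≤ c`. -/
theorem supNorm_le_iff {S : Set W} {c : ℝ≥0∞} : supNorm S ≤ c ↔ ∀ s ∈ S, ‖s‖ₑ ≤ c :=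
  iSup₂_le_iff

/-- Monotonicity of `|S|` in `S`. -/
theorem supNorm_mono {S T : Set W} (h : S ⊆ T) : supNorm S ≤ supNorm T :=
  supNorm_le_iff.2 fun _ hs => enorm_le_supNorm (h hs)

/-- `|∅| = 0` (convention). -/
@[simp] theorem supNorm_empty : supNorm (∅ : Set W) = 0 := by
  simp [supNorm]

/-- `|{w}| = ‖w‖` (used for `S_p = {1}` in §7.6.8). -/
@[simp] theorem supNorm_singleton (w : W) : supNorm ({w} : Set W) = ‖w‖ₑ := by
  simp [supNorm]

/-- The unit ball has size `≤ 1` (§7.6.8 «or `S_p` is the unit ball in the `p`-component»). -/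
theorem supNorm_closedBall_le : supNorm (Metric.closedBall (0 : W) 1) ≤ 1 :=
  supNorm_le_iff.2 fun s hs => by
    rw [← ofReal_norm, ← ENNReal.ofReal_one]
    exact ENNReal.ofReal_le_ofReal (mem_closedBall_zero_iff.1 hs)

/-- … and size exactly `1` as soon as it contains an element of norm `1` (e.g. `1` when `‖1‖ = 1`). -/
theorem supNorm_closedBall_eq_one {w : W} (hw : ‖w‖ = 1) : supNorm (Metric.closedBall (0 : W) 1) = 1 :=
  le_antisymm supNorm_closedBall_le <| by
    have hmem : w ∈ Metric.closedBall (0 : W) 1 := mem_closedBall_zero_iff.2 hw.le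
    have h := enorm_le_supNorm hmem
    rwa [← ofReal_norm, hw, ENNReal.ofReal_one] at h

end Sizes

section LowerBound

variable {ι : Type*} [Fintype ι] {𝕜 : Type*} [NontriviallyNormedField 𝕜]
  {V : ι → Type*} [∀ i, SeminormedAddCommGroup (V i)] [∀ i, NormedSpace 𝕜 (V i)]

/-- **Lemma 7.6.6.1 (7.6.6.3) — DERIVED** [J-III p. 64 l. 27–37]: «if `S ⊂ ⊗_α V_α` is a subset containing some pure tensor
`⊗_α m_α` then `sup{|s| : s ∈ S} ≥ ∏_α |m_α|_{V_α}`», GIVEN the cross-norm identity (7.6.6.2) `‖⨂ₜ m‖ = ∏ ‖m_α‖` for that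
pure tensor (hypothesis `h`: = `TensorNorm.norm_tprod m` over `ℝ`, `ℂ`; = Joshi's `TensorNorm.CrossNormClaim` (Thm 7.6.2.2
(3)) over a p-adic field). -/
theorem prod_enorm_le_supNorm {S : Set (⨂[𝕜] i, V i)} {m : Π i, V i}
    (h : ‖(⨂ₜ[𝕜] i, m i)‖ = ∏ i, ‖m i‖) (hm : (⨂ₜ[𝕜] i, m i) ∈ S) : ∏ i, ‖m i‖ₑ ≤ supNorm S := by
  have hx : ‖(⨂ₜ[𝕜] i, m i)‖ₑ = ∏ i, ‖m i‖ₑ := by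
    rw [← ofReal_norm, h, ENNReal.ofReal_prod_of_nonneg fun i _ => norm_nonneg _]
    exact Finset.prod_congr rfl fun i _ => ofReal_norm (m i)
  rw [← hx]
  exact enorm_le_supNorm hm

/-- Unconditionally (any field, no cross-norm input): an exhibited element bounds the size from below, `‖⨂ₜ m‖ ≤ |S|`;
with Mathlib's `‖⨂ₜ m‖ ≤ ∏ ‖m_α‖` this is all one gets without (7.6.6.2). -/
theorem enorm_tprod_le_supNorm {S : Set (⨂[𝕜] i, V i)} {m : Π i, V i} (hm : (⨂ₜ[𝕜] i, m i) ∈ S) :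
    ‖(⨂ₜ[𝕜] i, m i)‖ₑ ≤ supNorm S :=
  enorm_le_supNorm hm

end LowerBound

/-! ## 2. §7.6.7–7.6.9: adelic sizes and (bounded) adelic type; the §7.6.8 shape behind Lemma 7.6.9.1 -/

section Adelic

variable {P : Type*} {W : P → Type*} [∀ p, SeminormedAddCommGroup (W p)]

/-- **§7.6.7 local size `|S_p|`** [J-III p. 64 l. 52–53]: for a family of subsets `S_p ⊆ W_p` indexed by «primes» `p : P`
(Joshi: `W_p = ⊗_α V_{α,p}`, `P` = the rational primes), `|S_p| = sup{|s_p| : s_p ∈ S_p}`. -/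
def localSize (S : ∀ p, Set (W p)) (p : P) : ℝ≥0∞ :=
  supNorm (S p)

/-- **§7.6.7 adelic size `|S| = ∏_p |S_p| ∈ ℝ ∪ {∞}`** [J-III p. 64 l. 54–58] «with the convention that `∞ · ∞ = ∞`,
`0 · ∞ = ∞`»: typed as `∞` if some `|S_p| = ∞`, and otherwise the product over all `p` of the `|S_p|` as a `finprod`
(= the finite product over the `p` with `|S_p| ≠ 1` when there are finitely many such `p`, i.e. for sets of adelic type —
the only case print uses, §7.6.8; junk value `1` otherwise). -/
def adelicSize (S : ∀ p, Set (W p)) : ℝ≥0∞ := by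
  classical
  exact if ∃ p, localSize S p = ∞ then ∞ else ∏ᶠ p, localSize S p

/-- **§7.6.9 (1) ADELIC TYPE** [J-III p. 65 l. 3–4]: «`S` is a set of adelic type if `|S_p| = 1` for all but finitely many
primes `p`». -/
def IsAdelicType (S : ∀ p, Set (W p)) : Prop :=
  {p | localSize S p ≠ 1}.Finite

/-- **§7.6.9 (2) BOUNDED ADELIC TYPE** [J-III p. 65 l. 5–6]: «`S` is a set of bounded adelic type if `S` is a set of adelic type
and `|S_p| < ∞` for every prime `p`». -/
def IsBoundedAdelicType (S : ∀ p, Set (W p)) : Prop :=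
  IsAdelicType S ∧ ∀ p, localSize S p < ∞

/-- Joshi's convention `0 · ∞ = ∞ · ∞ = ∞`, DERIVED from the typing: `|S| = ∞` iff some `|S_p| = ∞`. -/
theorem adelicSize_eq_top_iff (S : ∀ p, Set (W p)) : adelicSize S = ∞ ↔ ∃ p, localSize S p = ∞ := by
  classical
  unfold adelicSize
  split_ifs with h
  · simp [h]
  · simp only [h, iff_false]
    push Not at h
    exact finprod_induction (fun x : ℝ≥0∞ => x ≠ ∞) ENNReal.one_ne_top (fun _ _ hx hy => ENNReal.mul_ne_top hx hy) h

/-- For a set of adelic type with all `|S_p| < ∞`, `|S|` is the FINITE product of the `|S_p|` over the exceptional primes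
(`|S_p| ≠ 1`) — the reading of `∏_p |S_p|` print intends (§7.6.8 p. 64 l. 65–67). -/
theorem adelicSize_eq_prod {S : ∀ p, Set (W p)} (h : IsBoundedAdelicType S) :
    adelicSize S = ∏ p ∈ h.1.toFinset, localSize S p := by
  classical
  have hne : ¬ ∃ p, localSize S p = ∞ := fun ⟨p, hp⟩ => (h.2 p).ne hp
  unfold adelicSize
  rw [if_neg hne]
  exact finprod_eq_prod_of_mulSupport_subset _ (by simp [Function.mulSupport])

/-- **DERIVED** [J-III §7.6.8 p. 64 l. 65–67 «So `|S| < ∞` in the principal case of interest»]: a set of bounded adelic type has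
finite adelic size. -/
theorem adelicSize_lt_top {S : ∀ p, Set (W p)} (h : IsBoundedAdelicType S) : adelicSize S < ∞ := by
  rw [adelicSize_eq_prod h]
  exact ENNReal.prod_lt_top fun p _ => (h.2 p)

/-- **DERIVED (the content of Lemma 7.6.9.1 via §7.6.8)** [J-III p. 64 l. 59–67, p. 65 l. 7–10]: if outside a finite set `F` of
primes every `S_p` has size `1` (print: `S_p = {1}` with `‖1‖ = 1`, or the unit ball — `supNorm_singleton`,
`supNorm_closedBall_eq_one`), then `S` is of adelic type. The instance «`Θ̃^{B_{L′}}_Joshi` and its variants have this shape»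
is stated by the seats typing the loci (abc-iut-E-t11 `J3:Def6.10.2`, abc-iut-E-t13 `J3:(7.5.4.1)`). -/
theorem isAdelicType_of_subset {S : ∀ p, Set (W p)} (F : Set P) (hF : F.Finite)
    (hoff : ∀ p ∉ F, localSize S p = 1) : IsAdelicType S :=
  hF.subset fun p hp => by
    by_contra hpF
    exact hp (hoff p hpF)

/-- Bounded adelic type from the same data plus finiteness of the exceptional sizes («one expects `|S_p| < ∞`», p. 64 l. 67,
typed as a hypothesis). -/
theorem isBoundedAdelicType_of_subset {S : ∀ p, Set (W p)} (F : Set P) (hF : F.Finite)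
    (hoff : ∀ p ∉ F, localSize S p = 1) (hfin : ∀ p ∈ F, localSize S p < ∞) : IsBoundedAdelicType S :=
  ⟨isAdelicType_of_subset F hF hoff, fun p => by
    by_cases hp : p ∈ F
    · exact hfin p hp
    · rw [hoff p hp]; exact ENNReal.one_lt_top⟩

end Adelic

end Summit.ABC.IUTFork.Joshi.TensorNorm

end
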